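import Literature.Barriers.ValiantsHypothesis.GCTUsefulModules
import Literature.Computability.AlgebraicComplexity.BIPPaddingDegenerations
import HarnessLib

/-!
# The Kadish–Landsberg first-row bound is attained: boundary modules `p₁ = d(n-m)` occur in
# `ℂ[\overline{GL · ℓ^{n-m} perm_m}]` (barrier audit of `GCTUsefulModules`, D-0021)

Companion of `Literature/Barriers/ValiantsHypothesis/GCTUsefulModules.lean`. That barrier (a tree
theorem, `gctUsefulModules_holds`) blocks the partitions `π ⊢ d·m` with a SHORT first row
`π₁ < d(m-n)` (tree letters: permanent size `n`, determinant size `m`, padded permanent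
`X₀₀^{m-n} per_n`): they do not occur in the coordinate ring of the orbit closure `Z` of the padded
permanent (Kadish–Landsberg 2014, Thm. 1.2; Landsberg 2017, Prop. 8.4.2.1; BIP 2019, Thm. 4.9(2)).
Landsberg's printed summary, Prop. 8.4.2.4, states the necessary condition with STRICT
inequalities ("we must have `l < m² + 1`, and `p₁ > d(n-m)`"), which would also exclude the
boundary `p₁ = d(n-m)`; Kadish–Landsberg's partial converse (Landsberg 2017, Prop. 8.9.2.1:
modules with `p₁ ≥ min{d(n-1), dn-m}` are not in `I_d(Pad)`) leaves the range
`d(n-m) ≤ p₁ < min{d(n-1), dn-m}` undecided, and their Rem. 1.4 warns that there usefulness may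
depend on the realisation of the module.

This file PROVES that the boundary is attained inside the orbit closure of the padded permanent
itself: for `0 < n` and `2n ≤ m`, the partition `(2(m-n), 2n) ⊢ 2m` — first row EXACTLY
`d(m-n)` with `d = 2`, two parts, maximal body `|π̄| = d n` — occurs in `ℂ[Z]_2`
(`hasHighestWeight_paddedPerOrbitRep_boundary`), so it is not a short-row candidate only by
equality (`not_isShortRowCandidate_boundary`, `boundary_sup_eq`): the necessary condition
`p₁ ≥ d(m-n)` of the barrier cannot be sharpened to exclude the boundary, and the strict
inequality of the printed summary is not what the padding argument (Prop. 8.4.2.1) yields — an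
occurring module of `ℂ[Z]` has `p₁ = d(m-n)` (`exists_hasHighestWeight_sup_eq`). Whether such a
boundary module can be GCT-useful AGAINST `det_m` is a separate (determinant-side) question: for
`4n ≤ m` the same partition occurs in `ℂ[Ω_m]` by BIP Prop. 2.3 (tree theorem
`bip2019_prop_2_3_holds`, `k = 2`, `ℓ = 2n`), so there it is no occurrence obstruction
(`boundary_not_isOccurrenceObstruction`); for `2n ≤ m < 4n` the determinant side is not decided
in the tree. The highest-weight vector is the tree's dual
hyperdeterminant of the `2 × 2n` rectangle on the top two letters `v < u` (`CplxAlg.hyperdetPoly`,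
BIP Cor. 4.8) lifted by BIP's inner degree lifting (`CplxAlg.innerLift`, Thm. 5.4) — exactly the
vector of BIP Prop. 2.3 for `k = 2`, `ℓ = 2n` — but evaluated at the DEGENERATION
`u^{m-n} v^n = u^{m-2n} · (u^n v^n) ∈ Z` of the padded permanent (`X₀₀ ↦ u`, block diagonal `↦ v`,
all other variables `↦ 0`), where its value is `± #{σ} · ((m-n)!/n! / C(2n,n))² ≠ 0`
(`hyperdet_indicator_ne_zero`: on two letters the hyperdeterminant of an array supported on the
words of one balanced content is a signed multiple of a positive count). In source letters
(permanent `m`, determinant `n`): `(2(n-m), 2m)` occurs in `ℂ[\overline{GL_{n²} · ℓ^{n-m} perm_m}]_2`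
for `n ≥ 2m`, with `p₁ = 2(n-m) = d(n-m)`.

## References

* [LandsbergGCT2017] J. M. Landsberg, *Geometry and Complexity Theory*, CUP 2017, Prop. 8.4.2.1,
  Prop. 8.4.2.4 (the strict printed form), Prop. 8.9.2.1 (partial converse).
* [KadishLandsberg2014] H. Kadish, J. M. Landsberg, Comm. Algebra 42 (2014), Thm. 1.2, Rem. 1.4,
  Question 1.5.
* [BurgisserIkenmeyerPanovaJAMS2019] P. Bürgisser, C. Ikenmeyer, G. Panova, J. AMS 32 (2019) =
  arXiv:1604.06431v3, Prop. 2.3, Cor. 4.8, Thm. 4.9, Thm. 5.4.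
-/

noncomputable section

open MvPolynomial

namespace Literature.Barriers.ValiantsHypothesis

open Literature.NumberTheory.DiophantineGeometry Literature.Computability.Complexity
  Literature.Computability.AlgebraicComplexity

/-! ### Permutations of two letters -/

/-- A permutation of `Fin 2` is the identity or the transposition. [folklore] -/
theorem perm_fin_two_eq (π : Equiv.Perm (Fin 2)) : π = 1 ∨ π = Equiv.swap 0 1 := by
  have h01 : ∀ x : Fin 2, x = 0 ∨ x = 1 := by decide
  rcases h01 (π 0) with h0 | h0
  · left
    have h1 : π 1 = 1 := by
      rcases h01 (π 1) with h1 | h1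
      · exact absurd (π.injective (h1.trans h0.symm)) (by decide)
      · exact h1
    exact Equiv.ext (Fin.forall_fin_two.2 ⟨by simpa using h0, by simpa using h1⟩)
  · right
    have h1 : π 1 = 0 := by
      rcases h01 (π 1) with h1 | h1
      · exact h1
      · exact absurd (π.injective (h1.trans h0.symm)) (by decide)
    refine Equiv.ext (Fin.forall_fin_two.2 ⟨?_, ?_⟩)
    · rw [h0, Equiv.swap_apply_left]
    · rw [h1, Equiv.swap_apply_right]

/-- The second value of a permutation of `Fin 2` is the transposition of the first. [folklore] -/
theorem perm_fin_two_apply_one (π : Equiv.Perm (Fin 2)) : π 1 = Equiv.swap 0 1 (π 0) := by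
  rcases perm_fin_two_eq π with rfl | rfl
  · simp
  · simp

/-- The sign of a permutation of `Fin 2`, read off its value at `0`. [folklore] -/
theorem sign_perm_fin_two_cast {R : Type*} [CommRing R] (π : Equiv.Perm (Fin 2)) :
    ((Equiv.Perm.sign π : ℤˣ) : R) = if π 0 = 0 then 1 else -1 := by
  rcases perm_fin_two_eq π with rfl | rfl
  · simp
  · rw [Equiv.Perm.sign_swap (by decide), Equiv.swap_apply_left, if_neg (by decide)]
    simp

/-! ### Words in two letters: contents -/

section TwoLetterWords

variable {τ : Type*} {ℓ : ℕ}

/-- The contents of a two-letter word and of its letter-swapped word add up to the constant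
content `ℓ (ε_{t 0} + ε_{t 1})`. [folklore] -/
theorem wordExp_add_wordExp_swap (t : Fin 2 → τ) (J : Fin ℓ → Fin 2) :
    wordExp (t ∘ J) + wordExp (t ∘ (Equiv.swap (0 : Fin 2) 1 ∘ J)) =
      ∑ _j : Fin ℓ, (Finsupp.single (t 0) 1 + Finsupp.single (t 1) 1) := by
  have h01 : ∀ x : Fin 2, x = 0 ∨ x = 1 := by decide
  unfold wordExp
  rw [← Finset.sum_add_distrib]
  refine Finset.sum_congr rfl fun j _ => ?_
  simp only [Function.comp_apply]
  rcases h01 (J j) with h | h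
  · rw [h, Equiv.swap_apply_left]
  · rw [h, Equiv.swap_apply_right, add_comm]

/-- The number of letters `t 1` in a two-letter word on injective letters `t`. [folklore] -/
theorem wordExp_comp_apply_one [DecidableEq τ] {t : Fin 2 → τ} (ht : Function.Injective t)
    (J : Fin ℓ → Fin 2) :
    wordExp (t ∘ J) (t 1) = (Finset.univ.filter fun j => J j = 1).card := by
  rw [wordExp_apply]
  congr 1
  refine Finset.filter_congr fun j _ => ?_
  simp only [Function.comp_apply]
  exact ht.eq_iff

/-- The product of the signs of an `ℓ`-tuple of permutations of `Fin 2` is `(-1)^{#swaps}`.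
[folklore] -/
theorem prod_sign_perm_fin_two (σ' : Fin ℓ → Equiv.Perm (Fin 2)) :
    (∏ j, ((Equiv.Perm.sign (σ' j) : ℤˣ) : ℂ)) =
      (-1) ^ (Finset.univ.filter fun j => σ' j 0 = 1).card := by
  have h01 : ∀ x : Fin 2, x = 0 ∨ x = 1 := by decide
  simp_rw [sign_perm_fin_two_cast]
  rw [Finset.prod_ite, Finset.prod_const_one, one_mul, Finset.prod_const]
  congr 1
  refine congrArg Finset.card (Finset.filter_congr fun j _ => ?_)
  rcases h01 (σ' j 0) with h | h
  · rw [h]; decide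
  · rw [h]; decide

/-- **The hyperdeterminant of a balanced indicator array on two letters is nonzero.** For an
array `A` on the words of length `ℓ` in two letters `t 0, t 1` (`t` injective) supported exactly
on the words with the content of a fixed word `J₀` whose letter swap has the same content
(balanced: as many `t 0` as `t 1`), with constant nonzero value `α` there, Cayley's first
hyperdeterminant is `± #{σ : word(σ) balanced} · α² ≠ 0`: in the expansion over
`σ : Fin ℓ → S₂` the two rows are a word and its letter swap, so a term survives iff the first
row is balanced, and then its sign `(-1)^{#swaps} = (-1)^{e₀(t 1)}` is constant.
[cite: BurgisserIkenmeyerPanovaJAMS2019, Cor. 4.8 (the analogous nonvanishing for power sums)] -/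
theorem hyperdet_indicator_ne_zero [DecidableEq τ] {t : Fin 2 → τ} (ht : Function.Injective t)
    (J₀ : Fin ℓ → Fin 2)
    (hbal : wordExp (t ∘ (Equiv.swap (0 : Fin 2) 1 ∘ J₀)) = wordExp (t ∘ J₀))
    (A : (Fin ℓ → Fin 2) → ℂ) (α : ℂ) (hα : α ≠ 0)
    (hA : ∀ J, A J = if wordExp (t ∘ J₀) = wordExp (t ∘ J) then α else 0) :
    hyperdet A ≠ 0 := by
  classical
  -- the total content of a word and its swap is `e₀ + e₀`
  have htot : ∀ J : Fin ℓ → Fin 2, wordExp (t ∘ J) + wordExp (t ∘ (Equiv.swap (0 : Fin 2) 1 ∘ J)) =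
      wordExp (t ∘ J₀) + wordExp (t ∘ J₀) := fun J => by
    rw [wordExp_add_wordExp_swap, ← wordExp_add_wordExp_swap t J₀, hbal]
  -- each term of the expansion
  have hsummand : ∀ σ' : Fin ℓ → Equiv.Perm (Fin 2),
      (∏ j, ((Equiv.Perm.sign (σ' j) : ℤˣ) : ℂ)) * ∏ i : Fin 2, A (fun j => σ' j i) =
        if wordExp (t ∘ J₀) = wordExp (t ∘ fun j => σ' j 0)
          then (-1) ^ (wordExp (t ∘ J₀) (t 1)) * (α * α) else 0 := by
    intro σ'
    rw [Fin.prod_univ_two]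
    have h1 : (fun j => σ' j 1) = Equiv.swap (0 : Fin 2) 1 ∘ fun j => σ' j 0 :=
      funext fun j => perm_fin_two_apply_one (σ' j)
    rw [h1, hA, hA]
    by_cases hS : wordExp (t ∘ J₀) = wordExp (t ∘ fun j => σ' j 0)
    · have hS' : wordExp (t ∘ J₀) = wordExp (t ∘ (Equiv.swap (0 : Fin 2) 1 ∘ fun j => σ' j 0)) := by
        have h := htot (fun j => σ' j 0)
        rw [← hS] at h
        exact (add_left_cancel h).symm
      rw [if_pos hS, if_pos hS', if_pos hS, prod_sign_perm_fin_two,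
        ← wordExp_comp_apply_one ht (fun j => σ' j 0), ← hS]
    · rw [if_neg hS, zero_mul, mul_zero, if_neg hS]
  rw [hyperdet, Finset.sum_congr rfl fun σ' _ => hsummand σ', Finset.sum_ite, Finset.sum_const_zero,
    add_zero, Finset.sum_const, nsmul_eq_mul]
  refine mul_ne_zero ?_ (mul_ne_zero (pow_ne_zero _ (neg_ne_zero.mpr one_ne_zero)) (mul_ne_zero hα hα))
  rw [Nat.cast_ne_zero, ← Nat.pos_iff_ne_zero, Finset.card_pos]
  refine ⟨fun j => if J₀ j = 0 then 1 else Equiv.swap 0 1,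
    Finset.mem_filter.mpr ⟨Finset.mem_univ _, ?_⟩⟩
  have h01 : ∀ x : Fin 2, x = 0 ∨ x = 1 := by decide
  congr 1
  funext j
  simp only [Function.comp_apply]
  rcases h01 (J₀ j) with h | h
  · rw [h, if_pos rfl, Equiv.Perm.one_apply]
  · rw [h, if_neg (by decide), Equiv.swap_apply_left]

end TwoLetterWords

/-! ### The degeneration `u^{m-n} v^n` of the padded permanent -/

/-- A block-diagonal position of the bottom-right `n × n` block of an `m × m` matrix (`n < m`) is
not the padding position `(0,0)`. [folklore] -/
theorem toLex_block_ne_zero {n m : ℕ} [NeZero m] (hnm : n < m) (a b : BlockIdx n m) :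
    (toLex ((a : Fin m), (b : Fin m)) : MatIdx m) ≠ toLex ((0 : Fin m), (0 : Fin m)) := by
  intro h
  have h1 : (a : Fin m) = 0 := (Prod.mk.inj (toLex.injective h)).1
  have h2 : m - n ≤ ((a : Fin m) : ℕ) := a.2
  rw [h1, Fin.val_zero] at h2
  omega

/-- **The degeneration of the padded permanent to a monomial.** The partial renaming
`X₀₀ ↦ X_u`, `X_{bb} ↦ X_v` (`b` in the block), every other variable `↦ 0`, sends
`X₀₀^{m-n} per_n(block)` to `X_u^{m-n} X_v^n` (the permanent of the diagonal matrix `v · 1` is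
`v^n`); stated for an arbitrary decidability instance of the renamed set of variables.
[cite: MulmuleySohoniSIAM2001, §4 (End-orbit degenerations)] -/
theorem aeval_degeneration_paddedPerFormLex (n m : ℕ) [NeZero m] (hnm : n < m) (u v : MatIdx m)
    (P : MatIdx m → Prop) {hdec : DecidablePred P}
    (hP : ∀ i, P i ↔ (i = toLex ((0 : Fin m), (0 : Fin m)) ∨
      ∃ b : BlockIdx n m, i = toLex ((b : Fin m), (b : Fin m))))
    (r : MatIdx m → MatIdx m) (hr0 : r (toLex ((0 : Fin m), (0 : Fin m))) = u)
    (hr : ∀ b : BlockIdx n m, r (toLex ((b : Fin m), (b : Fin m))) = v) :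
    aeval (fun i => if P i then (X (r i) : MvPolynomial (MatIdx m) ℂ) else 0)
      (paddedPerFormLex ℂ n m) = X u ^ (m - n) * X v ^ n := by
  rw [paddedPerFormLex_eq, map_mul, map_pow, aeval_X, aeval_rename, aeval_perPoly,
    if_pos ((hP _).2 (Or.inl rfl)), hr0]
  congr 1
  have hperm : ∀ M : Matrix (BlockIdx n m) (BlockIdx n m) (MvPolynomial (MatIdx m) ℂ),
      (∀ a b, M a b = if a = b then X v else 0) → M.permanent = X v ^ n := by
    intro M hM
    have hMd : M = Matrix.diagonal fun _ => X v := by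
      ext a b
      rw [hM, Matrix.diagonal_apply]
    rw [hMd, Matrix.permanent_diagonal, Finset.prod_const, Finset.card_univ, card_blockIdx hnm.le]
  refine hperm _ fun a b => ?_
  rw [Matrix.of_apply, Function.comp_apply]
  by_cases hab : a = b
  · subst hab
    rw [if_pos ((hP _).2 (Or.inr ⟨a, rfl⟩)), hr a, if_pos rfl]
  · have hnP : ¬ P (toLex ((a : Fin m), (b : Fin m))) := by
      rw [hP]
      rintro (h | ⟨b', hb'⟩)
      · exact toLex_block_ne_zero hnm a b h
      · obtain ⟨h1, h2⟩ := Prod.mk.inj (toLex.injective hb')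
        exact hab (Subtype.ext (h1.trans h2.symm))
    rw [if_neg hnP, if_neg hab]

/-- The first coordinate of the degree index of a word is its content (unfolding). [folklore] -/
theorem wordDegIdx_val {τ : Type*} [Fintype τ] [DecidableEq τ] {kk ℓ : ℕ} (t : Fin kk → τ)
    (J : Fin ℓ → Fin kk) : (wordDegIdx t J).1 = wordExp (t ∘ J) :=
  rfl

/-! ### The boundary partition `(2(m-n), 2n) ⊢ 2m` occurs -/

/-- **The Kadish–Landsberg bound is attained (the boundary module occurs).** For `0 < n` and
`2n ≤ m`, the weight of the partition `(2(m-n), 2n) ⊢ 2·m` (the row-extended rectangle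
`(2 × 2n)♯(2m)` of BIP Prop. 2.3) occurs in the coordinate ring `ℂ[Z]` of the orbit closure of
the padded permanent `X₀₀^{m-n} per_n`: its first row `2(m-n) = d(m-n)` (`d = 2`) sits exactly on
the boundary of the Kadish–Landsberg necessary condition. Proof: the dual hyperdeterminant of
the `2 × 2n` rectangle on the top two letters, lifted by `innerLift` (weight
`((2 × 2n)♯(2m))^*`, `rectWeight_add_single_eq`), does not vanish at the degeneration
`u^{m-n} v^n ∈ Z` of the padded permanent, where its value is the hyperdeterminant of a balanced
indicator array (`hyperdet_indicator_ne_zero`); functions of `I(GL · X₀₀^{m-n} per_n)` vanish on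
`Z` (`CplxAlg.mem_orbitClosure_iff_formCoeff_holds`).
[cite: LandsbergGCT2017, Prop. 8.4.2.1 and Prop. 8.9.2.1] [cite: BurgisserIkenmeyerPanovaJAMS2019, Prop. 2.3, Cor. 4.8 and Thm. 5.4] -/
theorem hasHighestWeight_paddedPerOrbitRep_boundary (n m : ℕ) [NeZero m] (hn : 0 < n)
    (hnm : 2 * n ≤ m) :
    HasHighestWeight (paddedPerOrbitRep ℂ n m)
      (partitionWeightLex m (rowExtendedRectangle 2 (2 * n) (2 * m))) := by
  classical
  rw [two_mul n]
  have hnm' : n ≤ m := by omega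
  have hnltm : n < m := by omega
  have h2 : 2 ≤ m * m := le_trans (by omega : 2 ≤ m) (Nat.le_mul_self m)
  have hℓm : n + n ≤ m := by omega
  -- letters `t 0 < t 1 = iₘ` and the top index
  set t := topLetters m 2 h2 with ht
  have htmono : StrictMono t := topLetters_strictMono m 2 h2
  have htinj : Function.Injective t := htmono.injective
  set iₘ := topMatIdx m with hiₘ'
  have hiₘ : ∀ i, i ≤ iₘ := le_topMatIdx m
  have ht1 : t 1 = iₘ := topLetters_last m 2 h2 (by norm_num)
  -- the lifted hyperdeterminant and its weight
  set F : MvPolynomial (DegIdx (MatIdx m) (n + n)) ℂ := hyperdetPoly (n + n) t with hF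
  have hFw := hyperdetPoly_mem_highestWeightSpace (k := ℂ) (ℓ := n + n) htmono
    (topLetters_upper m 2 h2)
  have hFd := isHomogeneous_hyperdetPoly (k := ℂ) (ℓ := n + n) t
  have hhw := innerLift_mem_highestWeightSpace iₘ hiₘ hℓm hFd hFw
  rw [rectWeight_add_single_eq m 2 (n + n) two_pos hℓm h2] at hhw
  change HasHighestWeight (orbitCoordRep (paddedPerFormLex ℂ n m) m) _
  refine hasHighestWeight_orbitCoordRep_of_not_mem _ m hhw ?_
  intro hI
  -- the balanced word `J₀ = 1⋯1 0⋯0` and the monomial `p = u^n v^n` of its content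
  set J₀ : Fin (n + n) → Fin 2 := Fin.append (fun _ : Fin n => (1 : Fin 2)) (fun _ : Fin n => 0)
    with hJ₀
  have hflip : (Equiv.swap (0 : Fin 2) 1 ∘ J₀) = J₀ ∘ (finAddFlip : Fin (n + n) ≃ Fin (n + n)) := by
    funext j
    induction j using Fin.addCases with
    | left i =>
      simp only [Function.comp_apply, hJ₀, Fin.append_left, finAddFlip_apply_castAdd,
        Fin.append_right, Equiv.swap_apply_right]
    | right i =>
      simp only [Function.comp_apply, hJ₀, Fin.append_right, finAddFlip_apply_natAdd,
        Fin.append_left, Equiv.swap_apply_left]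
  have hbal : wordExp (t ∘ (Equiv.swap (0 : Fin 2) 1 ∘ J₀)) = wordExp (t ∘ J₀) := by
    rw [hflip]
    exact wordExp_comp_perm (t ∘ J₀) finAddFlip
  set p : MvPolynomial (MatIdx m) ℂ := ∏ j, X ((t ∘ J₀) j) with hp
  have hpmon : p = monomial (wordExp (t ∘ J₀)) 1 := prod_X_eq_monomial_wordExp (t ∘ J₀)
  have hpeq : p = X (t 1) ^ n * X (t 0) ^ n := by
    rw [hp, Fin.prod_univ_add]
    simp only [Function.comp_apply, hJ₀, Fin.append_left, Fin.append_right, Finset.prod_const,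
      Finset.card_univ, Fintype.card_fin]
  have hphom : p.IsHomogeneous (n + n) := by
    rw [hpmon]
    exact isHomogeneous_monomial _ (degree_wordExp _)
  -- the degeneration `q₀ = u^{m-2n} p = u^{m-n} v^n` of the padded permanent
  set q₀ : MvPolynomial (MatIdx m) ℂ := X iₘ ^ (m - (n + n)) * p with hq₀
  have hq₀hom : q₀.IsHomogeneous m := by
    have h := (isHomogeneous_X_pow (R := ℂ) iₘ (m - (n + n))).mul hphom
    rwa [Nat.sub_add_cancel hℓm] at h
  have hq₀eq : q₀ = X iₘ ^ (m - n) * X (t 0) ^ n := by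
    rw [hq₀, hpeq, ht1, ← mul_assoc, ← pow_add]
    congr 2
    omega
  have hφ : aeval (fun i : MatIdx m =>
      if (i = toLex ((0 : Fin m), (0 : Fin m)) ∨ ∃ b : BlockIdx n m, i = toLex ((b : Fin m), (b : Fin m)))
      then (X (if i = toLex ((0 : Fin m), (0 : Fin m)) then iₘ else t 0) : MvPolynomial (MatIdx m) ℂ)
      else 0) (paddedPerFormLex ℂ n m) = q₀ := by
    rw [hq₀eq]
    exact aeval_degeneration_paddedPerFormLex n m hnltm iₘ (t 0) _ (fun i => Iff.rfl) _
      (if_pos rfl) (fun b => if_neg (toLex_block_ne_zero hnltm b b))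
  have hq₀mem : q₀ ∈ orbitClosure (paddedPerFormLex ℂ n m) := by
    rw [← hφ]
    exact endOrbit_subset_orbitClosure_holds _ (aeval_partialRename_mem_endOrbit _ _ _)
  have hf0 : paddedPerFormLex ℂ n m ≠ 0 := by
    intro h
    rw [h, map_zero, hq₀eq] at hφ
    exact mul_ne_zero (pow_ne_zero _ (X_ne_zero iₘ)) (pow_ne_zero _ (X_ne_zero (t 0))) hφ.symm
  -- functions of the orbit ideal vanish on the orbit closure ...
  have hzero : aeval (formCoeff m q₀) (innerLift iₘ (n + n) m F) = 0 := by
    have h := ((mem_orbitClosure_iff_formCoeff_holds (paddedPerFormLex_isHomogeneous ℂ hnm')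
      hf0).mp hq₀mem).2
    rw [MvPolynomial.mem_zeroLocus_iff] at h
    exact h _ hI
  -- ... but the lifted hyperdeterminant does not vanish at `q₀`
  have hval : aeval (formCoeff m q₀) (innerLift iₘ (n + n) m F) ≠ 0 := by
    rw [aeval_formCoeff_innerLift iₘ hq₀hom, hq₀]
    have hpt : formCoeff (n + n) (iterPderiv iₘ (m - (n + n)) (X iₘ ^ (m - (n + n)) * p)) =
        fun e : DegIdx (MatIdx m) (n + n) =>
          (((e.1 iₘ + (m - (n + n))).descFactorial (m - (n + n)) : ℕ) : ℂ) *
            formCoeff (n + n) p e :=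
      funext fun e => formCoeff_iterPderiv_X_pow_mul iₘ (m - (n + n)) hphom e
    rw [hpt, hF, aeval_hyperdetPoly]
    -- the array is the balanced indicator of the content of `J₀`, with value `α`
    set K₀ : ℕ := (Finset.univ.filter fun I : Fin (n + n) → MatIdx m =>
      wordExp I = wordExp (t ∘ J₀)).card with hK₀
    set c₀ : ℕ := ((wordExp (t ∘ J₀)) iₘ + (m - (n + n))).descFactorial (m - (n + n)) with hc₀
    have hK₀pos : 0 < K₀ := card_filter_wordExp_pos (t ∘ J₀)
    have hc₀pos : 0 < c₀ := descFactorial_add_pos _ _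
    refine hyperdet_indicator_ne_zero htinj J₀ hbal _ ((K₀ : ℂ)⁻¹ * (c₀ : ℂ))
      (mul_ne_zero (inv_ne_zero (Nat.cast_ne_zero.mpr hK₀pos.ne')) (Nat.cast_ne_zero.mpr hc₀pos.ne'))
      fun J => ?_
    rw [formCoeff_apply, wordDegIdx_val t J, hpmon, coeff_monomial]
    by_cases h : wordExp (t ∘ J₀) = wordExp (t ∘ J)
    · rw [if_pos h, if_pos h, mul_one, ← h]
    · rw [if_neg h, if_neg h, mul_zero, mul_zero]
  exact hval hzero

/-- The first row of the boundary partition `(2(m-n), 2n) ⊢ 2m` is exactly `d(m-n)`, `d = 2`,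
and it has at most `2 ≤ m²` parts. [cite: BurgisserIkenmeyerPanovaJAMS2019, §2(a)] -/
theorem boundary_sup_eq (n m : ℕ) (hnm : 2 * n ≤ m) :
    (rowExtendedRectangle 2 (2 * n) (2 * m)).parts.sup = 2 * (m - n) ∧
      (rowExtendedRectangle 2 (2 * n) (2 * m)).parts.card ≤ 2 := by
  have h : 2 * (2 * n) ≤ 2 * m := by omega
  refine ⟨?_, ?_⟩
  · rw [sup_parts_eq_getD_sortedParts, rowExtendedRectangle,
      getD_sortedParts_partitionOfRows (antitone_rowExtRectRows h) (sum_range_rowExtRectRows two_pos h)]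
    simp only [Nat.zero_lt_two, if_true, rowExtRectRows]
    omega
  · rw [rowExtendedRectangle]
    exact card_parts_partitionOfRows_le (antitone_rowExtRectRows h) (sum_range_rowExtRectRows two_pos h)

/-- Hence the boundary partition is NOT a short-row candidate — but only by equality in
`π₁ ≥ d(m-n)`: the barrier `GCTUsefulModules` is sharp and cannot be extended to
`π₁ ≤ d(m-n)`. [cite: LandsbergGCT2017, Prop. 8.4.2.1 and Prop. 8.4.2.4] -/
theorem not_isShortRowCandidate_boundary (n m : ℕ) (hm : 2 ≤ m * m) (hnm : 2 * n ≤ m) :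
    ¬ IsShortRowCandidate n m 2 (rowExtendedRectangle 2 (2 * n) (2 * m)) ∧
      (rowExtendedRectangle 2 (2 * n) (2 * m)).parts.card ≤ m * m ∧
      (rowExtendedRectangle 2 (2 * n) (2 * m)).parts.sup = 2 * (m - n) := by
  obtain ⟨hsup, hcard⟩ := boundary_sup_eq n m hnm
  refine ⟨fun h => ?_, hcard.trans hm, hsup⟩
  have h2 := h.2
  rw [hsup] at h2
  exact lt_irrefl _ h2

/-- **The tree's non-strict barrier is exact; the strict inequality of the printed summary
(Landsberg, Prop. 8.4.2.4: "`p₁ > d(n-m)`", source letters) does not follow from the padding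
argument.** For every `0 < n` and determinant size `m ≥ 2n` there is a partition `π ⊢ d·m`
(`d = 2`, at most `m²` parts) with first row EQUAL to `d(m-n)` — hence not a short-row candidate —
whose weight occurs in `ℂ[\overline{GL_{m²} · X₀₀^{m-n} per_n}]`: the padded permanent does not
exclude the boundary modules, and the barrier `GCTUsefulModules` (`p₁ < d(m-n)` blocked) cannot
be extended to `p₁ ≤ d(m-n)`.
[cite: LandsbergGCT2017, Prop. 8.4.2.1 and Prop. 8.4.2.4] [cite: KadishLandsberg2014, Thm. 1.2 and Rem. 1.4] -/
theorem exists_hasHighestWeight_sup_eq (n m : ℕ) [NeZero m] (hn : 0 < n) (hnm : 2 * n ≤ m) :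
    ∃ pi : Nat.Partition (2 * m), pi.parts.card ≤ m * m ∧ pi.parts.sup = 2 * (m - n) ∧
      ¬ IsShortRowCandidate n m 2 pi ∧
      HasHighestWeight (paddedPerOrbitRep ℂ n m) (partitionWeightLex m pi) := by
  have hm : 2 ≤ m * m := le_trans (by omega : 2 ≤ m) (Nat.le_mul_self m)
  obtain ⟨hnot, hcard, hsup⟩ := not_isShortRowCandidate_boundary n m hm hnm
  exact ⟨_, hcard, hsup, hnot, hasHighestWeight_paddedPerOrbitRep_boundary n m hn hnm⟩

/-- **At the boundary, permanent and determinant agree once `4n ≤ m`.** The boundary partition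
`(2(m-n), 2n) ⊢ 2m` occurs in `ℂ[Z]` (this file) AND in `ℂ[Ω_m] = ℂ[\overline{GL_{m²} · det_m}]`
(BIP Prop. 2.3 with `k = 2`, `ℓ = 2n` even, `kℓ ≤ m`: tree theorem `bip2019_prop_2_3_holds`), so
it is no occurrence obstruction (`IsOccurrenceObstruction`): the boundary module left open by the
barrier is useless against `det_m` in this range for a determinant-side reason, not by padding.
(For `2n ≤ m < 4n` the determinant side is not decided here.)
[cite: BurgisserIkenmeyerPanovaJAMS2019, Prop. 2.3] [cite: LandsbergGCT2017, Prop. 8.4.2.4] -/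
theorem boundary_not_isOccurrenceObstruction (n m : ℕ) [NeZero m] (hn : 0 < n)
    (hnm : 2 * (2 * n) ≤ m) :
    HasHighestWeight (paddedPerOrbitRep ℂ n m)
        (partitionWeightLex m (rowExtendedRectangle 2 (2 * n) (2 * m))) ∧
      HasHighestWeight (detOrbitRep ℂ m)
        (partitionWeightLex m (rowExtendedRectangle 2 (2 * n) (2 * m))) ∧
      ¬ IsOccurrenceObstruction n m (partitionWeightLex m (rowExtendedRectangle 2 (2 * n) (2 * m))) := by
  have hdet := bip2019_prop_2_3_holds m 2 (2 * n) two_pos (by omega) (even_two_mul n) hnm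
  exact ⟨hasHighestWeight_paddedPerOrbitRep_boundary n m hn (by omega), hdet, fun h => h.2 hdet⟩

end Literature.Barriers.ValiantsHypothesis
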